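import Summits.CriticalPhenomena.PercolationContinuityZ3.Theorems.SahiMasterFamilyLocalToGlobalFourCases

/-!
# The local-to-global step at order four (THEOREM LG4), III: the theorem

Unit `prim-master-conj` (crux anchor stmt-CriticalPhenomena-4575), gen 11; memo HOME/prim-master-conj/TIGHTNESS-III.md §2.

  **`lg4`** / **`lg4_of_noAbsorber`** (THEOREM LG4): a family of four non-empty, non-sure increasing events (on all of `κ`) with structured
  contraction faces, support-disjoint glued frames, a core-free coordinate, structured deletion faces at the core-free coordinates (consistent with the
  glued frames — automatic when no member contains the others, `faceFConsistent_of_noAbsorber`), and NO structured deletion `W ∖ x` — does not exist.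

Proof: at least two pure members (`two_le_card_pure`), at least two non-pure ones (else a deletion is a pure independent family), so exactly
`2 + 2`, and part II (`LG4Data.false_of_not_structured`) applies.  Pure combinatorics; axioms standard. [this work]
-/

noncomputable section

open scoped Classical

namespace Summit.CriticalPhenomena.PercolationContinuityZ3.Theorems

namespace GluedFrames

open Finset Function
open Literature.Probability.LatticeModels.Kahn2022 (Affects)

variable {ι : Type*} [Fintype ι] {κ : Type*}

/-! ### THEOREM LG4 -/

/-- **THEOREM LG4 (TIGHTNESS-III §2): the local-to-global step at order four.**  There is no family of four non-empty, non-sure increasing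
events (indexed by all of `κ`, `W.card = 4`) such that: every contraction face is structured; the glued frames have pairwise disjoint essential
supports; some coordinate is core-free and every deletion face at a core-free coordinate is structured and consistent with the glued frames;
every coordinate has a companion (`|ι| ≥ 2`); and NO deletion `W ∖ x` is structured. [this work] -/
theorem lg4 (U : κ → Set (Set ι)) (W : Finset κ) (hU : ∀ k, IsUpperSet (U k)) (hne : ∀ k, (U k).Nonempty)
    (hns : ∀ k, U k ≠ Set.univ) (hWU : ∀ k, k ∈ W) (hcard : W.card = 4) (hS : ∀ h, Structured (faceT U h) W)
    (hd : ∀ x ∈ W, ∀ x' ∈ W, x ≠ x' → Disjoint (esupp (gframe U W x)) (esupp (gframe U W x')))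
    (hF : ∀ f, CoreFree U f → Structured (faceF U f) W ∧ FaceFConsistent U W f) (hE0 : ∃ f, CoreFree U f)
    (hι : ∀ f : ι, ∃ h, h ≠ f) (hdel : ∀ x ∈ W, ¬ Structured U (W.erase x)) : False := by
  -- pure members: at least two
  set P := W.filter fun x => gann U W x = ∅ with hPdef
  have hP2 : 2 ≤ P.card := two_le_card_pure U W hU hne hWU hS hd hF hE0 (by omega) hι
  -- non-pure members: at least two (else some deletion consists of pure, pairwise independent members)
  set N := W.filter fun x => gann U W x ≠ ∅ with hNdef
  have hpure_struct : ∀ R : Finset κ, (∀ x ∈ R, gann U W x = ∅) → R ⊆ W → Structured U R := by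
    intro R hR hRW
    refine structured_of_pairwise_disjoint U hU fun x hx x' hx' hxx' => ?_
    have e1 := (gann_eq_empty_iff U W hU x).1 (hR x hx)
    have e2 := (gann_eq_empty_iff U W hU x').1 (hR x' hx')
    have := hd x (hRW hx) x' (hRW hx') hxx'
    rwa [e1, e2] at this
  have hN2 : 2 ≤ N.card := by
    by_contra hlt
    push Not at hlt
    -- choose `x` with every other member pure
    obtain ⟨x, hxW, hx⟩ : ∃ x ∈ W, ∀ y ∈ W.erase x, gann U W y = ∅ := by
      rcases Nat.lt_or_ge N.card 1 with h0 | h1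
      · have hN0 : N = ∅ := card_eq_zero.1 (by omega)
        obtain ⟨x, hx⟩ : W.Nonempty := card_pos.1 (by omega)
        refine ⟨x, hx, fun y hy => ?_⟩
        by_contra hy'
        have : y ∈ N := mem_filter.2 ⟨mem_of_mem_erase hy, hy'⟩
        rw [hN0] at this; exact notMem_empty y this
      · obtain ⟨x, hx⟩ := card_pos.1 (by omega : 0 < N.card)
        refine ⟨x, (mem_filter.1 hx).1, fun y hy => ?_⟩
        by_contra hy'
        have hyN : y ∈ N := mem_filter.2 ⟨mem_of_mem_erase hy, hy'⟩
        have : ({x, y} : Finset κ) ⊆ N := by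
          intro z hz; simp only [mem_insert, mem_singleton] at hz; rcases hz with rfl | rfl <;> assumption
        have hc := card_le_card this
        rw [card_pair (ne_of_mem_erase hy).symm] at hc
        omega
    exact hdel x hxW (hpure_struct _ hx (erase_subset x W))
  -- so exactly two pure `a, b` and two non-pure `v, w`
  have hPN : P.card + N.card = W.card := by
    rw [hPdef, hNdef]; exact Finset.card_filter_add_card_filter_not (s := W) (fun x => gann U W x = ∅)
  obtain ⟨a, ha, b, hb, hab⟩ := one_lt_card.1 (by omega : 1 < P.card)
  obtain ⟨v, hv, w, hw, hvw⟩ := one_lt_card.1 (by omega : 1 < N.card)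
  rw [hPdef, mem_filter] at ha hb
  rw [hNdef, mem_filter] at hv hw
  have hav : a ≠ v := fun e => hv.2 (e ▸ ha.2)
  have haw : a ≠ w := fun e => hw.2 (e ▸ ha.2)
  have hbv : b ≠ v := fun e => hv.2 (e ▸ hb.2)
  have hbw : b ≠ w := fun e => hw.2 (e ▸ hb.2)
  -- `W = {a, b, v, w}`
  have hWeq : W = {a, b, v, w} := by
    symm
    apply eq_of_subset_of_card_le
    · intro x hx; simp only [mem_insert, mem_singleton] at hx
      rcases hx with rfl | rfl | rfl | rfl
      exacts [ha.1, hb.1, hv.1, hw.1]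
    · rw [hcard, card_insert_of_notMem (by simp [hab, hav, haw]), card_insert_of_notMem (by simp [hbv, hbw]),
        card_pair hvw]
  have hrest : ∀ u ∈ W, u = a ∨ u = b ∨ u = v ∨ u = w := by
    intro u hu; rw [hWeq] at hu; simpa only [mem_insert, mem_singleton] using hu
  have D : LG4Data U W a b v w :=
    { hU := hU, hne := hne, hns := hns, hWU := hWU, hS := hS, hd := hd, hF := hF, hE0 := hE0, hι := hι,
      hab := hab, hav := hav, haw := haw, hbv := hbv, hbw := hbw, hvw := hvw,
      hrestv := fun u hu huv => by
        rcases hrest u hu with h | h | h | h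
        · exact Or.inl h
        · exact Or.inr (Or.inl h)
        · exact absurd h huv
        · exact Or.inr (Or.inr h),
      hrestw := fun u hu huw => by
        rcases hrest u hu with h | h | h | h
        · exact Or.inl h
        · exact Or.inr (Or.inl h)
        · exact Or.inr (Or.inr h)
        · exact absurd h huw,
      hpa := ha.2, hpb := hb.2, hNv := Set.nonempty_iff_ne_empty.2 hv.2 }
  have hev : W.erase w = insert v ({a, b} : Finset κ) := by
    ext x; rw [mem_erase, hWeq]; simp only [mem_insert, mem_singleton]
    constructor
    · rintro ⟨hxw, h⟩; rcases h with h | h | h | h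
      · exact Or.inr (Or.inl h)
      · exact Or.inr (Or.inr h)
      · exact Or.inl h
      · exact absurd h hxw
    · rintro (h | h | h)
      · exact ⟨h ▸ hvw, Or.inr (Or.inr (Or.inl h))⟩
      · exact ⟨h ▸ haw, Or.inl h⟩
      · exact ⟨h ▸ hbw, Or.inr (Or.inl h)⟩
  have hew : W.erase v = insert w ({a, b} : Finset κ) := by
    ext x; rw [mem_erase, hWeq]; simp only [mem_insert, mem_singleton]
    constructor
    · rintro ⟨hxv, h⟩; rcases h with h | h | h | h
      · exact Or.inr (Or.inl h)
      · exact Or.inr (Or.inr h)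
      · exact absurd h hxv
      · exact Or.inl h
    · rintro (h | h | h)
      · exact ⟨h ▸ hvw.symm, Or.inr (Or.inr (Or.inr h))⟩
      · exact ⟨h ▸ hav, Or.inl h⟩
      · exact ⟨h ▸ hbv, Or.inr (Or.inl h)⟩
  refine D.false_of_not_structured (Set.nonempty_iff_ne_empty.2 hw.2) ?_ ?_
  · rw [← hev]; exact hdel w hw.1
  · rw [← hew]; exact hdel v hv.1

/-- **THEOREM LG4, face-vanishing form**: the same with hypothesis (c) as in TIGHTNESS-III — the deletion faces at core-free coordinates are
STRUCTURED — and (e) NO MEMBER CONTAINS ALL THE OTHERS; consistency of the deletion faces is Lemma 1.3 (`faceFConsistent_of_noAbsorber`).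
[this work] -/
theorem lg4_of_noAbsorber (U : κ → Set (Set ι)) (W : Finset κ) (hU : ∀ k, IsUpperSet (U k)) (hne : ∀ k, (U k).Nonempty)
    (hns : ∀ k, U k ≠ Set.univ) (hWU : ∀ k, k ∈ W) (hcard : W.card = 4) (hS : ∀ h, Structured (faceT U h) W)
    (hd : ∀ x ∈ W, ∀ x' ∈ W, x ≠ x' → Disjoint (esupp (gframe U W x)) (esupp (gframe U W x')))
    (hF : ∀ f, CoreFree U f → Structured (faceF U f) W) (hE0 : ∃ f, CoreFree U f) (hι : ∀ f : ι, ∃ h, h ≠ f)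
    (habs : ∀ l ∈ W, ∃ m ∈ W, m ≠ l ∧ ¬ U m ⊆ U l) (hdel : ∀ x ∈ W, ¬ Structured U (W.erase x)) : False :=
  lg4 U W hU hne hns hWU hcard hS hd
    (fun f hf => ⟨hF f hf, faceFConsistent_of_noAbsorber U W hU hne hns hS hd habs (by omega) hf (hF f hf)⟩) hE0 hι hdel

end GluedFrames

end Summit.CriticalPhenomena.PercolationContinuityZ3.Theorems
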